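import Mathlib
import HarnessLib
import Summits.HubbardSuperconductivity.HubbardSuperconductivity.Theorems.KLProgrammeKLRegimeCountertermJacksonSecondOrder
import Summits.HubbardSuperconductivity.HubbardSuperconductivity.Theorems.KLProgrammeKLRegimeCountertermJacksonFrameDeriv
import Summits.HubbardSuperconductivity.HubbardSuperconductivity.Theorems.KLProgrammeKLRegimeCountertermJacksonSplitDefs
import Literature.Analysis.FluidPDE.CheskidovShvydkoyAssembly

/-!
# Route `KLProgramme`, crux K3 — gen-5 ENGINE child (`stub_twoLeg_step`, (E3a-MS) supplier, recipe (L)+(F), plan g12 STATUS l.1769):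
# JACKSON BOUNDS FOR THE WEIGHTED TRANSLATE INTEGRAL, vector-valued — `‖∫ J̃J̃·(H(x − w) − H(x))‖ ≤ π⁶/(d+1)·‖DH‖∞` and
# `≤ 2π⁷/(d+1)²·‖D²H‖∞` for `H` with values in any complete normed space

Seat hubbard-kl-k3c3-p1 (g3), package (P1) of MS-DESIGN-NOTE §3–§4 (evidence #29 on stmt-…-19855).  Since `𝒥_d` commutes with derivatives
(k3c3-p2's `contDiff_integral_translate`: `Dʲ(𝒥_d F) = ∫∫ J̃J̃ · DʲF(· − w)`), Jackson gains for DERIVATIVES of the high part `(1 − 𝒥_d)F` follow from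
first/second-order estimates for the weighted translate integral applied to the VECTOR-valued map `H = Dʲ(F ∘ ofLp)`.  This file proves them:

* §1 vector-valued Taylor bounds `norm_sub_le_of_iteratedFDeriv_one`, `norm_sub_sub_add_fderiv_le` (mean value inequality on `[0,1]`);
* §2 the smoothing square's measure `jmeas`, the product weight `jweight d`, the shift `jshift`, integrability of continuous integrands, the
  moments `∫J̃J̃ = 1`, `∫J̃J̃·s = ∫J̃J̃·t = 0`, `∫J̃J̃(s²+t²) ≤ 2π⁷/(d+1)²`, `∫J̃J̃(|s|+|t|) ≤ π⁶/(d+1)`;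
* §3 **`norm_integral_jweight_sub_le_first/second`** (with `‖Dʲ(Dⁿf)‖ = ‖Dⁿ⁺ʲf‖` from `Literature.Analysis.FluidPDE`, folklore), the vanishing of the linear term
  `integral_jweight_smul_clm_jshift`, and `integral_jweight_smul_const`.

Pure real analysis; nothing about the model.  Consumed by `…CountertermJacksonHighPart`.
-/

noncomputable section

namespace Summit.HubbardSuperconductivity.HubbardSuperconductivity.Theorems.KLRegimeSplit

set_option linter.dupNamespace false -- summit = problem name (single-conjunct summit), D-0017

open Real MeasureTheory Filter
open Literature.Analysis.Fourier.TrigApprox Literature.MathematicalPhysics.QuantumLattice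

/-! ## §1 Vector-valued Taylor bounds of orders one and two -/

section TaylorV

variable {E V : Type*} [NormedAddCommGroup E] [NormedSpace ℝ E] [NormedAddCommGroup V] [NormedSpace ℝ V] {G : E → V}

/-- `‖G(x − w) − G(x)‖ ≤ B₁‖w‖` from `‖D¹G‖ ≤ B₁` (`C¹`). -/
theorem norm_sub_le_of_iteratedFDeriv_one (hG : ContDiff ℝ 1 G) {B₁ : ℝ} (hB : ∀ y, ‖iteratedFDeriv ℝ 1 G y‖ ≤ B₁) (x w : E) :
    ‖G (x - w) - G x‖ ≤ B₁ * ‖w‖ := by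
  have hdiff : Differentiable ℝ G := hG.differentiable (by norm_num)
  have hB' : ∀ y, ‖fderiv ℝ G y‖ ≤ B₁ := fun y => by
    rw [← norm_iteratedFDeriv_zero (𝕜 := ℝ) (f := fderiv ℝ G) (x := y), norm_iteratedFDeriv_fderiv]; exact hB y
  have h := Convex.norm_image_sub_le_of_norm_fderiv_le (fun z _ => hdiff z) (fun z _ => hB' z) convex_univ (Set.mem_univ x)
    (Set.mem_univ (x - w))
  simpa [sub_sub_cancel_left, norm_neg] using h

/-- `‖D(DG)(y)‖ = ‖D²G(y)‖` (vector-valued). -/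
theorem norm_fderiv_fderiv_eq_norm_iteratedFDeriv_two' (G : E → V) (y : E) :
    ‖fderiv ℝ (fderiv ℝ G) y‖ = ‖iteratedFDeriv ℝ 2 G y‖ := by
  rw [← norm_iteratedFDeriv_zero (𝕜 := ℝ) (f := fderiv ℝ (fderiv ℝ G)) (x := y), norm_iteratedFDeriv_fderiv,
    norm_iteratedFDeriv_fderiv]

/-- **Second-order Taylor bound, vector-valued**: `‖G(x − w) − G(x) + DG(x)w‖ ≤ B₂‖w‖²` for `G ∈ C²` with `‖D²G‖ ≤ B₂`
(mean value inequality for `τ ↦ G(x − τw) + τ·DG(x)w` on `[0,1]`, whose derivative is `(DG(x) − DG(x − τw))w`). -/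
theorem norm_sub_sub_add_fderiv_le (hG : ContDiff ℝ 2 G) {B₂ : ℝ} (hB : ∀ y, ‖iteratedFDeriv ℝ 2 G y‖ ≤ B₂) (x w : E) :
    ‖G (x - w) - G x + fderiv ℝ G x w‖ ≤ B₂ * ‖w‖ ^ 2 := by
  have hGd : Differentiable ℝ G := hG.differentiable (by norm_num)
  have h1 : ContDiff ℝ 1 (fderiv ℝ G) := hG.fderiv_right (m := 1) (by norm_num)
  have hdiff : Differentiable ℝ (fderiv ℝ G) := h1.differentiable (by norm_num)
  have hlip : ∀ y z : E, ‖fderiv ℝ G y - fderiv ℝ G z‖ ≤ B₂ * ‖y - z‖ := fun y z =>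
    Convex.norm_image_sub_le_of_norm_fderiv_le (fun u _ => hdiff u)
      (fun u _ => by rw [norm_fderiv_fderiv_eq_norm_iteratedFDeriv_two']; exact hB u) convex_univ (Set.mem_univ z) (Set.mem_univ y)
  set φ : ℝ → V := fun τ => G (x - τ • w) + τ • fderiv ℝ G x w with hφ
  have hφ' : ∀ τ, HasDerivAt φ ((fderiv ℝ G x - fderiv ℝ G (x - τ • w)) w) τ := by
    intro τ
    have ha : HasDerivAt (fun τ : ℝ => x - τ • w) (-w) τ := by
      have := ((hasDerivAt_id τ).smul_const w).const_sub x
      simpa using this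
    have hb : HasDerivAt (G ∘ fun τ : ℝ => x - τ • w) (fderiv ℝ G (x - τ • w) (-w)) τ :=
      (hGd (x - τ • w)).hasFDerivAt.comp_hasDerivAt τ ha
    have hc : HasDerivAt (fun τ : ℝ => τ • fderiv ℝ G x w) (fderiv ℝ G x w) τ := by
      simpa using (hasDerivAt_id τ).smul_const (fderiv ℝ G x w)
    have hsum := hb.add hc
    have e : fderiv ℝ G (x - τ • w) (-w) + fderiv ℝ G x w = (fderiv ℝ G x - fderiv ℝ G (x - τ • w)) w := by
      rw [map_neg, show (fderiv ℝ G x - fderiv ℝ G (x - τ • w)) w = fderiv ℝ G x w - fderiv ℝ G (x - τ • w) w from rfl]; abel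
    rw [e] at hsum
    exact hsum
  have hB0 : 0 ≤ B₂ := le_trans (norm_nonneg _) (hB x)
  have hbound : ∀ τ ∈ Set.Ico (0 : ℝ) 1, ‖(fderiv ℝ G x - fderiv ℝ G (x - τ • w)) w‖ ≤ B₂ * ‖w‖ ^ 2 := by
    intro τ hτ
    calc ‖(fderiv ℝ G x - fderiv ℝ G (x - τ • w)) w‖ ≤ ‖fderiv ℝ G x - fderiv ℝ G (x - τ • w)‖ * ‖w‖ :=
          ContinuousLinearMap.le_opNorm _ _
      _ ≤ B₂ * ‖x - (x - τ • w)‖ * ‖w‖ := mul_le_mul_of_nonneg_right (hlip _ _) (norm_nonneg _)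
      _ ≤ B₂ * ‖w‖ * ‖w‖ := by
          gcongr
          rw [sub_sub_cancel, norm_smul, Real.norm_eq_abs, abs_of_nonneg hτ.1]
          exact mul_le_of_le_one_left (norm_nonneg _) hτ.2.le
      _ = B₂ * ‖w‖ ^ 2 := by ring
  have hmv := norm_image_sub_le_of_norm_deriv_le_segment_01' (fun τ _ => (hφ' τ).hasDerivWithinAt) hbound
  have e1 : φ 1 = G (x - w) + fderiv ℝ G x w := by simp [hφ]
  have e0 : φ 0 = G x := by simp [hφ]
  rw [e1, e0] at hmv
  have e2 : G (x - w) + fderiv ℝ G x w - G x = G (x - w) - G x + fderiv ℝ G x w := by abel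
  rw [e2] at hmv
  exact hmv

end TaylorV

/-! ## §2 The weighted translate integral with the Jackson product weight -/

section Weight

variable (d : ℕ)

/-- The weight is continuous. -/
theorem continuous_jweight : Continuous (jweight d) :=
  ((continuous_jker d).comp continuous_fst).mul ((continuous_jker d).comp continuous_snd)

/-- The weight is bounded. -/
theorem jweight_le (w : ℝ × ℝ) : jweight d w ≤ (π ^ 4 * (d + 1) / 8 / (2 * π)) * (π ^ 4 * (d + 1) / 8 / (2 * π)) :=
  mul_le_mul (jker_le_const d w.1) (jker_le_const d w.2) (jker_nonneg d w.2) (le_trans (jker_nonneg d w.1) (jker_le_const d w.1))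

/-- The shift is continuous. -/
theorem continuous_jshift : Continuous jshift := by
  refine (PiLp.continuous_toLp 2 _).comp ?_
  refine continuous_pi fun i => ?_
  fin_cases i <;> simp <;> fun_prop

/-- The smoothing square's measure is the restriction of Lebesgue measure on `ℝ²` to the square. -/
theorem jmeas_eq_restrict : (jmeas : Measure (ℝ × ℝ)) = (volume : Measure (ℝ × ℝ)).restrict (Set.Ioc (-π) π ×ˢ Set.Ioc (-π) π) := by
  rw [show (volume : Measure (ℝ × ℝ)) = (volume : Measure ℝ).prod volume from rfl, ← Measure.prod_restrict]

/-- Integrability of a continuous function against the smoothing square's measure. -/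
theorem integrable_jmeas_of_continuous {W : Type*} [NormedAddCommGroup W] {f : ℝ × ℝ → W} (hf : Continuous f) :
    Integrable f jmeas := by
  rw [jmeas_eq_restrict]
  exact (hf.continuousOn.integrableOn_compact ((isCompact_Icc (a := -π) (b := π)).prod
    (isCompact_Icc (a := -π) (b := π)))).mono_set (Set.prod_mono Set.Ioc_subset_Icc_self Set.Ioc_subset_Icc_self)

/-- `∫ J̃J̃ dμ = 1`. -/
theorem integral_jweight : ∫ w, jweight d w ∂jmeas = 1 := integral_jker_prod d

/-- `∫ J̃(s)J̃(t)·s dμ = 0`. -/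
theorem integral_jweight_mul_fst : ∫ w, jweight d w * w.1 ∂jmeas = 0 := by
  have hππ : -π ≤ π := by linarith [Real.pi_pos]
  have e : (fun w : ℝ × ℝ => jweight d w * w.1) = fun w => (w.1 * jker d w.1) * jker d w.2 := by
    funext w; simp only [jweight]; ring
  rw [e, MeasureTheory.integral_prod_mul (μ := volume.restrict (Set.Ioc (-π) π)) (ν := volume.restrict (Set.Ioc (-π) π))
    (f := fun s => s * jker d s) (g := fun t => jker d t)]
  rw [← intervalIntegral.integral_of_le hππ, integral_mul_jker_eq_zero, zero_mul]

/-- `∫ J̃(s)J̃(t)·t dμ = 0`. -/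
theorem integral_jweight_mul_snd : ∫ w, jweight d w * w.2 ∂jmeas = 0 := by
  have hππ : -π ≤ π := by linarith [Real.pi_pos]
  have e : (fun w : ℝ × ℝ => jweight d w * w.2) = fun w => jker d w.1 * (w.2 * jker d w.2) := by
    funext w; simp only [jweight]; ring
  rw [e, MeasureTheory.integral_prod_mul (μ := volume.restrict (Set.Ioc (-π) π)) (ν := volume.restrict (Set.Ioc (-π) π))
    (f := fun s => jker d s) (g := fun t => t * jker d t)]
  rw [← intervalIntegral.integral_of_le hππ (f := fun t => t * jker d t), integral_mul_jker_eq_zero, mul_zero]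

/-- `∫ J̃J̃·(s² + t²) dμ ≤ 2π⁷/(d+1)²`. -/
theorem integral_jweight_mul_normSq_le : ∫ w, jweight d w * (w.1 ^ 2 + w.2 ^ 2) ∂jmeas ≤ 2 * π ^ 7 / (d + 1) ^ 2 := by
  have hππ : -π ≤ π := by linarith [Real.pi_pos]
  have hm := integral_sq_mul_jker_le d
  have e : (fun w : ℝ × ℝ => jweight d w * (w.1 ^ 2 + w.2 ^ 2)) =
      fun w => (w.1 ^ 2 * jker d w.1) * jker d w.2 + jker d w.1 * (w.2 ^ 2 * jker d w.2) := by
    funext w; simp only [jweight]; ring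
  have hj1 : Continuous fun w : ℝ × ℝ => jker d w.1 := (continuous_jker d).comp continuous_fst
  have hj2 : Continuous fun w : ℝ × ℝ => jker d w.2 := (continuous_jker d).comp continuous_snd
  have i1 : Integrable (fun w : ℝ × ℝ => (w.1 ^ 2 * jker d w.1) * jker d w.2) jmeas :=
    integrable_jmeas_of_continuous (((continuous_fst.pow 2).mul hj1).mul hj2)
  have i2 : Integrable (fun w : ℝ × ℝ => jker d w.1 * (w.2 ^ 2 * jker d w.2)) jmeas :=
    integrable_jmeas_of_continuous (hj1.mul ((continuous_snd.pow 2).mul hj2))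
  rw [e, integral_add i1 i2,
    MeasureTheory.integral_prod_mul (μ := volume.restrict (Set.Ioc (-π) π)) (ν := volume.restrict (Set.Ioc (-π) π))
      (f := fun s => s ^ 2 * jker d s) (g := fun t => jker d t),
    MeasureTheory.integral_prod_mul (μ := volume.restrict (Set.Ioc (-π) π)) (ν := volume.restrict (Set.Ioc (-π) π))
      (f := fun s => jker d s) (g := fun t => t ^ 2 * jker d t)]
  simp only [← intervalIntegral.integral_of_le hππ, integral_jker]
  have e2 : (∫ x in (-π)..π, x ^ 2 * jker d x) * 1 + 1 * ∫ x in (-π)..π, x ^ 2 * jker d x =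
      2 * ∫ x in (-π)..π, x ^ 2 * jker d x := by ring
  rw [e2]
  have : 2 * (π ^ 7 / ((d : ℝ) + 1) ^ 2) = 2 * π ^ 7 / (d + 1) ^ 2 := by ring
  linarith

/-- `∫ J̃J̃·(|s| + |t|) dμ ≤ π⁶/(d+1)`. -/
theorem integral_jweight_mul_absSum_le : ∫ w, jweight d w * (|w.1| + |w.2|) ∂jmeas ≤ π ^ 6 / (d + 1) := by
  have hππ : -π ≤ π := by linarith [Real.pi_pos]
  have hm := integral_abs_mul_jker_le d
  have e : (fun w : ℝ × ℝ => jweight d w * (|w.1| + |w.2|)) =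
      fun w => (|w.1| * jker d w.1) * jker d w.2 + jker d w.1 * (|w.2| * jker d w.2) := by
    funext w; simp only [jweight]; ring
  have hj1 : Continuous fun w : ℝ × ℝ => jker d w.1 := (continuous_jker d).comp continuous_fst
  have hj2 : Continuous fun w : ℝ × ℝ => jker d w.2 := (continuous_jker d).comp continuous_snd
  have i1 : Integrable (fun w : ℝ × ℝ => (|w.1| * jker d w.1) * jker d w.2) jmeas :=
    integrable_jmeas_of_continuous ((continuous_fst.abs.mul hj1).mul hj2)
  have i2 : Integrable (fun w : ℝ × ℝ => jker d w.1 * (|w.2| * jker d w.2)) jmeas :=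
    integrable_jmeas_of_continuous (hj1.mul (continuous_snd.abs.mul hj2))
  rw [e, integral_add i1 i2,
    MeasureTheory.integral_prod_mul (μ := volume.restrict (Set.Ioc (-π) π)) (ν := volume.restrict (Set.Ioc (-π) π))
      (f := fun s => |s| * jker d s) (g := fun t => jker d t),
    MeasureTheory.integral_prod_mul (μ := volume.restrict (Set.Ioc (-π) π)) (ν := volume.restrict (Set.Ioc (-π) π))
      (f := fun s => jker d s) (g := fun t => |t| * jker d t)]
  simp only [← intervalIntegral.integral_of_le hππ, integral_jker]
  have e2 : (∫ x in (-π)..π, |x| * jker d x) * 1 + 1 * ∫ x in (-π)..π, |x| * jker d x =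
      2 * ∫ x in (-π)..π, |x| * jker d x := by ring
  rw [e2]
  have hd : (0 : ℝ) < d + 1 := by positivity
  have : 2 * (π ^ 6 / (2 * ((d : ℝ) + 1))) = π ^ 6 / (d + 1) := by field_simp
  linarith

/-- `‖jshift w‖² = s² + t²`. -/
theorem norm_jshift_sq (w : ℝ × ℝ) : ‖jshift w‖ ^ 2 = w.1 ^ 2 + w.2 ^ 2 := norm_toLp_pair_sq w.1 w.2

/-- `‖jshift w‖ ≤ |s| + |t|`. -/
theorem norm_jshift_le (w : ℝ × ℝ) : ‖jshift w‖ ≤ |w.1| + |w.2| := by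
  have h := norm_jshift_sq w
  have h0 : 0 ≤ |w.1| + |w.2| := by positivity
  nlinarith [sq_nonneg (|w.1| + |w.2|), sq_abs w.1, sq_abs w.2, norm_nonneg (jshift w), abs_nonneg w.1, abs_nonneg w.2,
    sq_nonneg (‖jshift w‖ - (|w.1| + |w.2|))]

end Weight

/-! ## §3 Jackson bounds for the weighted translate integral (vector-valued) -/


section Translate

variable (d : ℕ) {V : Type*} [NormedAddCommGroup V] [NormedSpace ℝ V] [CompleteSpace V]

omit [CompleteSpace V] in
/-- **First-order bound for the weighted translate**: `‖∫ J̃J̃·(H(x − w) − H(x))‖ ≤ π⁶/(d+1)·B₁` for `H ∈ C¹` (values in any complete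
normed space) with `‖DH‖ ≤ B₁`. -/
theorem norm_integral_jweight_sub_le_first {H : EuclideanSpace ℝ (Fin 2) → V} (hH : ContDiff ℝ 1 H) {B₁ : ℝ}
    (hB : ∀ y, ‖iteratedFDeriv ℝ 1 H y‖ ≤ B₁) (x : EuclideanSpace ℝ (Fin 2)) :
    ‖∫ w, jweight d w • (H (x - jshift w) - H x) ∂jmeas‖ ≤ π ^ 6 / (d + 1) * B₁ := by
  have hB0 : 0 ≤ B₁ := le_trans (norm_nonneg _) (hB x)
  have hint : Integrable (fun w : ℝ × ℝ => jweight d w * (B₁ * (|w.1| + |w.2|))) jmeas :=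
    integrable_jmeas_of_continuous ((continuous_jweight d).mul (continuous_const.mul (continuous_fst.abs.add continuous_snd.abs)))
  calc ‖∫ w, jweight d w • (H (x - jshift w) - H x) ∂jmeas‖
      ≤ ∫ w, ‖jweight d w • (H (x - jshift w) - H x)‖ ∂jmeas := norm_integral_le_integral_norm _
    _ ≤ ∫ w, jweight d w * (B₁ * (|w.1| + |w.2|)) ∂jmeas := by
        refine integral_mono_of_nonneg (Eventually.of_forall fun w => norm_nonneg _) hint (Eventually.of_forall fun w => ?_)
        show ‖jweight d w • (H (x - jshift w) - H x)‖ ≤ jweight d w * (B₁ * (|w.1| + |w.2|))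
        rw [norm_smul, Real.norm_eq_abs, abs_of_nonneg (jweight_nonneg d w)]
        refine mul_le_mul_of_nonneg_left ?_ (jweight_nonneg d w)
        exact (norm_sub_le_of_iteratedFDeriv_one hH hB x (jshift w)).trans (mul_le_mul_of_nonneg_left (norm_jshift_le w) hB0)
    _ = B₁ * ∫ w, jweight d w * (|w.1| + |w.2|) ∂jmeas := by
        rw [← integral_const_mul]; exact integral_congr_ae (Eventually.of_forall fun w => by ring)
    _ ≤ B₁ * (π ^ 6 / (d + 1)) := mul_le_mul_of_nonneg_left (integral_jweight_mul_absSum_le d) hB0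
    _ = π ^ 6 / (d + 1) * B₁ := by ring

/-- The linear term integrates to zero against the even weight. -/
theorem integral_jweight_smul_clm_jshift (T : EuclideanSpace ℝ (Fin 2) →L[ℝ] V) :
    ∫ w, jweight d w • T (jshift w) ∂jmeas = 0 := by
  have e : ∀ w : ℝ × ℝ, jweight d w • T (jshift w) =
      (jweight d w * w.1) • T (WithLp.toLp 2 ![1, 0]) + (jweight d w * w.2) • T (WithLp.toLp 2 ![0, 1]) := by
    intro w
    have h : (jshift w : EuclideanSpace ℝ (Fin 2)) = w.1 • WithLp.toLp 2 ![1, 0] + w.2 • WithLp.toLp 2 ![0, 1] := by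
      ext i; fin_cases i <;> simp
    rw [h, map_add, map_smul, map_smul, smul_add, smul_smul, smul_smul]
  simp_rw [e]
  have i1 : Integrable (fun w : ℝ × ℝ => (jweight d w * w.1) • T (WithLp.toLp 2 ![1, 0])) jmeas :=
    (integrable_jmeas_of_continuous ((continuous_jweight d).mul continuous_fst)).smul_const _
  have i2 : Integrable (fun w : ℝ × ℝ => (jweight d w * w.2) • T (WithLp.toLp 2 ![0, 1])) jmeas :=
    (integrable_jmeas_of_continuous ((continuous_jweight d).mul continuous_snd)).smul_const _
  rw [integral_add i1 i2, integral_smul_const, integral_smul_const, integral_jweight_mul_fst, integral_jweight_mul_snd,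
    zero_smul, zero_smul, add_zero]

/-- **Second-order bound for the weighted translate**: `‖∫ J̃J̃·(H(x − w) − H(x))‖ ≤ 2π⁷/(d+1)²·B₂` for `H ∈ C²` with `‖D²H‖ ≤ B₂`
(the linear term vanishes against the even weight; the remainder is `≤ B₂(s² + t²)`). -/
theorem norm_integral_jweight_sub_le_second {H : EuclideanSpace ℝ (Fin 2) → V} (hH : ContDiff ℝ 2 H) {B₂ : ℝ}
    (hB : ∀ y, ‖iteratedFDeriv ℝ 2 H y‖ ≤ B₂) (x : EuclideanSpace ℝ (Fin 2)) :
    ‖∫ w, jweight d w • (H (x - jshift w) - H x) ∂jmeas‖ ≤ 2 * π ^ 7 / (d + 1) ^ 2 * B₂ := by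
  have hB0 : 0 ≤ B₂ := le_trans (norm_nonneg _) (hB x)
  have hHc : Continuous H := hH.continuous
  have hcR : Continuous fun w : ℝ × ℝ => jweight d w • (H (x - jshift w) - H x + fderiv ℝ H x (jshift w)) :=
    (continuous_jweight d).smul (((hHc.comp (continuous_const.sub continuous_jshift)).sub continuous_const).add
      ((fderiv ℝ H x).continuous.comp continuous_jshift))
  have hcL : Continuous fun w : ℝ × ℝ => jweight d w • fderiv ℝ H x (jshift w) :=
    (continuous_jweight d).smul ((fderiv ℝ H x).continuous.comp continuous_jshift)
  have hsplit : (∫ w, jweight d w • (H (x - jshift w) - H x) ∂jmeas) =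
      (∫ w, jweight d w • (H (x - jshift w) - H x + fderiv ℝ H x (jshift w)) ∂jmeas) -
        ∫ w, jweight d w • fderiv ℝ H x (jshift w) ∂jmeas := by
    rw [← integral_sub (integrable_jmeas_of_continuous hcR) (integrable_jmeas_of_continuous hcL)]
    refine integral_congr_ae (Eventually.of_forall fun w => ?_)
    show jweight d w • (H (x - jshift w) - H x) =
      jweight d w • (H (x - jshift w) - H x + (fderiv ℝ H x) (jshift w)) - jweight d w • (fderiv ℝ H x) (jshift w)
    rw [← smul_sub]; congr 1; abel
  rw [hsplit, integral_jweight_smul_clm_jshift, sub_zero]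
  have hint : Integrable (fun w : ℝ × ℝ => jweight d w * (B₂ * (w.1 ^ 2 + w.2 ^ 2))) jmeas :=
    integrable_jmeas_of_continuous ((continuous_jweight d).mul (continuous_const.mul
      ((continuous_fst.pow 2).add (continuous_snd.pow 2))))
  calc ‖∫ w, jweight d w • (H (x - jshift w) - H x + fderiv ℝ H x (jshift w)) ∂jmeas‖
      ≤ ∫ w, ‖jweight d w • (H (x - jshift w) - H x + fderiv ℝ H x (jshift w))‖ ∂jmeas := norm_integral_le_integral_norm _
    _ ≤ ∫ w, jweight d w * (B₂ * (w.1 ^ 2 + w.2 ^ 2)) ∂jmeas := by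
        refine integral_mono_of_nonneg (Eventually.of_forall fun w => norm_nonneg _) hint (Eventually.of_forall fun w => ?_)
        show ‖jweight d w • (H (x - jshift w) - H x + fderiv ℝ H x (jshift w))‖ ≤ jweight d w * (B₂ * (w.1 ^ 2 + w.2 ^ 2))
        rw [norm_smul, Real.norm_eq_abs, abs_of_nonneg (jweight_nonneg d w), ← norm_jshift_sq]
        exact mul_le_mul_of_nonneg_left (norm_sub_sub_add_fderiv_le hH hB x (jshift w)) (jweight_nonneg d w)
    _ = B₂ * ∫ w, jweight d w * (w.1 ^ 2 + w.2 ^ 2) ∂jmeas := by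
        rw [← integral_const_mul]; exact integral_congr_ae (Eventually.of_forall fun w => by ring)
    _ ≤ B₂ * (2 * π ^ 7 / (d + 1) ^ 2) := mul_le_mul_of_nonneg_left (integral_jweight_mul_normSq_le d) hB0
    _ = 2 * π ^ 7 / (d + 1) ^ 2 * B₂ := by ring

/-- Mass one against a constant vector: `∫ J̃J̃ • v = v`. -/
theorem integral_jweight_smul_const (v : V) : ∫ w, jweight d w • v ∂jmeas = v := by
  rw [integral_smul_const, integral_jweight, one_smul]

end Translate

end Summit.HubbardSuperconductivity.HubbardSuperconductivity.Theorems.KLRegimeSplit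

end
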